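/-
Copyright (c) 2026 the pub-hodgecm-mathlib formalisation cell (harness21).  Prover seat hodgecm-mathlib-K2E3-p28 (g3) (E3 hand lent to strike line L1 by CHAIR K2-lead (g2)
VALVE WORD W4; LEAD F0P6-plan (g14) BATCH #108 (3) «U1 STAGE-3 B2b `K2LiuSingularWhittakerPlaceFactor` census-first»), Track B «K2-LIT» ∕ hLiu418 =
stmt-HodgeConjecture-24832: organ U1-CT-ind stage 3 («U1-glob»), BRICK B2b of K2E3-p14 (g9)'s census `K2/K2E3-p14/g9/CENSUS-U1glob-Stage3.K2E3-p14-g9.md`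
15c482e7f33bfc56 §2 — «THE `v`-FACTOR OF THE CLEARED SINGULAR BIG-CELL LETTER: isolating one place of the Euler head, and transporting the factorisation from the
convergent half-plane to `{0 < re s}`».  THEOREMS ONLY.
-/
import Summits.HodgeConjecture.HodgeConjecture.Theorems.K2LiuFirstTermResidueForm                -- ★ U0 (K2Liu-p08): `continuousAt_half_of_differentiableOn`
import Summits.HodgeConjecture.HodgeConjecture.Theorems.K2LiuSiegelEisensteinResidueCoefficients    -- ★ I5-bridge (K2E5-p17): `eqOn_halfPlane_of_eqOn_right` (★ #47a with no poles)
import Mathlib.MeasureTheory.Constructions.Pi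
import Mathlib.MeasureTheory.Integral.Prod
import Mathlib.Data.Fintype.BigOperators
import HarnessLib

/-!
# Crux `HLiu418`, organ U1-CT-ind STAGE 3 («U1-glob»), brick B2b: THE PLACE FACTOR OF THE CLEARED SINGULAR BIG-CELL LETTER —
# (I) isolating ONE place `v₀ ∈ T` of the Euler head under a section pure at `v₀`, (T) transporting `W = Fn·Rst` from `{s₁ < re s}` to `Eac = Fn·G` on `{0 < re s}`
# [KudlaRallis1994 §2; Tan1999 §3; GanTakeda2011 Prop. 7.2]

Cell `hodgecm-mathlib`, crux item hLiu418 = `stmt-HodgeConjecture-24832`; squad K2, strike line L1, LEAD F0P6-plan (g14) (BATCH #108 (3)); desk K2E3-p14 (g9) + K2E5-p16 (g8);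
prover K2E3-p28 (g3).  Lane `--supports stmt-HodgeConjecture-24832 --as helper` (count-neutral).  THEOREMS ONLY (no `def`, no `instance`, no notation, no named-fact hypothesis,
no `sorry`, default heartbeats).  GENERIC: §1 in the index set and the measures, §2 in every letter.

THE POINT (census §1–§2, B1 → B2b → B4).  U1-glob («`φ` K-finite, pure at `v₀`, the local section `b` at `v₀` killed by the normalised intertwining operator at `½` ⇒
`resGen = 0`») is ★ I5's engine at `g := stdExtension 𝒦 ½ φ` with ONE letter replaced (B1 `K2LiuLocalKernelZeroResidue.resGen_eq_zero_of_localKernel_letters`,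
K2E3-p14 (g9)): instead of `hdead : WaStar X j ½ h = 0` the consumer takes the LOCAL-KERNEL FACTORISATION LETTER
  `hfac : ∃ (hv : Hv) (G : ℂ → ℂ), ContinuousAt G ½ ∧ ContinuousAt (Fn · hv) ½ ∧ ∀ s, 0 < re s → s ≠ ½ → WaStar X j s h = Fn s hv * G s`
together with `hFn0 : ∀ hv, Fn ½ hv = 0` (the rank-one tower step, B2a `K2LiuIntertwiningTowerRankOne`, K2E3-p06 (g6)).  Here `WaStar = Eac X · h` is the KIND-1 letter of record
(★ `K2LiuKindOneLettersOfRecord`: `Ea S _ := Eac S`), the CONTINUED `(s − ½)·`normalised singular big-cell Whittaker term, which the K1-a♮ package delivers EXISTENTIALLY —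
★ (K1a-4) `K2LiuRankOneSingularEulerContinued.exists_Eac_of_tail_letters`: `∃ Eac, (hEad) holomorphic on {0 < re s} ∧ (hEac) (s − ½)·W(s)(x) = Eac(s, x) on {1 < re s}`.
So `hfac` on ALL of `{0 < re s}` can only come from (i) a factorisation of the honest integral `W(s)(x)` on the CONVERGENT half-plane with the `v₀`-factor isolated, and (ii) the
identity theorem.  This file is exactly those two steps, hypothesis-first, and nothing else:
* §1 **`integral_prod_pi_eq_mul_of_pureAt`** (I, pure measure theory) — for a finite product measure `μA ⊗ ⨂_{i∈ι} μ_i`, a character-type weight `ΨA(a)·∏_i Ψ_i(q_i)` and an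
  integrand PURE AT `i₀` (`F(a, q) = B(q_{i₀})·R(a, q|_{i ≠ i₀})`): `∫ (ΨA·∏Ψ)·F d(μA ⊗ ⨂μ) = (∫ Ψ_{i₀}·B dμ_{i₀}) · ∫ (ΨA·∏_{i≠i₀}Ψ)·R d(μA ⊗ ⨂_{i≠i₀}μ)` — NO integrability
  hypothesis (both sides junk consistently: Mathlib `integral_prod_mul` after the measure-preserving coordinate split `measurePreserving_splitAt` =
  `measurePreserving_piEquivPiSubtypeProd` ∘ `measurePreserving_piUnique` ∘ shuffles).  This is the shape of ★ G1 `K2LiuWhittakerDeltaEulerProduct.whittakerDelta_eq_mul_tprod_euler`'s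
  HEAD `∫ [conj ψ_S(p_∞)·∏_{v∈T} conj ψ_S(ι_v p_v)]·fT_s(…) d(ν_∞ ⊗ ⨂_{v∈T} ν_v)` with `A := N_Δ(L ⊗ ℝ)`, `ι := ↥T`, `i₀ := v₀`: for `fT` pure at `v₀` the head is
  `W_{X,v₀}(b_s)(h_{v₀}) · HEAD_{T∖v₀}` (`integral_prod_pi_eq_mul_of_pureAt_translate` carries the two-sided translations `w_v·p_v·h_v` of the head's arguments).
* §2 **`waStar_eq_localValue_mul_of_letters`** ∕ **`exists_localKernel_factor_of_letters`** (T) — from K1-a♮'s `(hEad, hEac)` BY VALUE (`WaStar` holomorphic on `{0 < re}`,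
  `(s − ½)·W s = WaStar s` on `{s₁ < re}`), the isolated tail `W s = Fn s hv · Rst s` on `{s₁ < re}` (§1 at the carriers ∘ ★ G1), the local value `Fn(·, hv)` holomorphic on
  `{0 < re}` ((K1a-3) `K2LiuRankOneSingularLocalRegularity` at `v₀`) and a pole-cleared rest `(s − ½)·Rst s = G s` on `{s₁ < re}`, `G` holomorphic on `{0 < re}` ((K1a-4) §1
  `exists_Eac_of_tail_letters` applied to the `T∖v₀`-tail): `WaStar s = Fn s hv · G s` on ALL of `{0 < re s}` (★ `eqOn_halfPlane_of_eqOn_right` = ★ #47a `continuationsAgree` with no poles), packaged in B1's `hfac`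
  shape with the two continuity clauses (★ U0 `continuousAt_half_of_differentiableOn`).
What this file does NOT do (honest): the LOCAL READING at `v₀` — `Fn s hv = W_{X,v₀}(b_s)(hv)` equals `W^{(1)}_{x,v₀}(i* N_{2,v₀}(s) b_s)(hv)` up to a unit (cocycle Fubini
★ `K2LiuIteratedRankOneCocycle` before stage evaluation; [KudlaRallis1994 §2], [GanTakeda2011 Prop. 7.2]) — it is stated in B2a's operator currency (`N_{2,v}`, `i*`) and rides
with B2a ∕ the B4 assembler; nor `hFn0` (B2a); nor the instantiation of §1 at the adelic carriers inside ★ G1's 40-line head (B4's `hfac :=` line, by `exact` on §1).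
References: [KudlaRallis1994] S. Kudla, S. Rallis, Ann. of Math. 140 (1994), §2; [Tan1999] V. Tan, Canad. J. Math. 51 (1999), §3, §4 Prop. 4.8; [GanTakeda2011] W. T. Gan,
S. Takeda, Prop. 7.2; [MoeglinWaldspurger1995] C. Mœglin, J.-L. Waldspurger, CUP (1995), IV.1.9–IV.1.11; [Liu2021] Y. Liu, Invent. Math. (2021), App. B Lem. B.12;
[Folland1995] G. Folland, *A Course in Abstract Harmonic Analysis* (1995), §2.2 (product measures, Fubini).
HONEST LABEL.  Count-neutral helper: `HC_CM` is proved only modulo the 7 printed citations (2 remaining named inputs: hLiu418 = `stmt-HodgeConjecture-24832`,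
h413 = `stmt-HodgeConjecture-24833`) until rung 0 closes; U1-glob itself stays OPEN (bricks B2a ∕ local reading ∕ B3 ∕ B4 ∕ B5).
-/

set_option autoImplicit false
set_option linter.dupNamespace false -- the mandated namespace repeats `HodgeConjecture.HodgeConjecture`

noncomputable section

open scoped BigOperators Topology
open MeasureTheory MeasureTheory.Measure Set Filter
open Summit.HodgeConjecture.HodgeConjecture.Cruxes.HLiu418.K2LiuFirstTermResidueForm (continuousAt_half_of_differentiableOn)
open Summit.HodgeConjecture.HodgeConjecture.Cruxes.HLiu418.K2LiuSiegelEisensteinResidueCoefficients (eqOn_halfPlane_of_eqOn_right)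

namespace Summit.HodgeConjecture.HodgeConjecture.Cruxes.HLiu418.K2LiuSingularWhittakerPlaceFactor

/-! ## §1 (I) Isolating ONE coordinate of a finite product measure under an integrand pure at that coordinate -/

section Isolation

variable {ι : Type*} [Fintype ι] [DecidableEq ι] {α : ι → Type*} [∀ i, MeasurableSpace (α i)]
  (μ : ∀ i, Measure (α i)) [∀ i, SigmaFinite (μ i)]
  {A : Type*} [MeasurableSpace A] (μA : Measure A) [SigmaFinite μA] (i₀ : ι)

/-- **The coordinate split `A × Π_i α_i → α_{i₀} × (A × Π_{i ≠ i₀} α_i)`, `(a, q) ↦ (q_{i₀}, (a, q|_{i≠i₀}))`, is measure preserving** for `μA ⊗ ⨂_i μ_i` and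
`μ_{i₀} ⊗ (μA ⊗ ⨂_{i≠i₀} μ_i)` (Mathlib `measurePreserving_piEquivPiSubtypeProd` for the predicate `(· = i₀)`, `measurePreserving_piUnique` on the singleton factor, and the
associativity ∕ commutativity shuffles `measurePreserving_prodAssoc`, `measurePreserving_swap`). [cite: Folland1995, §2.2] -/
theorem measurePreserving_splitAt :
    MeasurePreserving (fun z : A × (∀ i, α i) => (z.2 i₀, (z.1, fun i : {i // i ≠ i₀} => z.2 i.1)))
      (μA.prod (Measure.pi μ)) ((μ i₀).prod (μA.prod (Measure.pi fun i : {i // i ≠ i₀} => μ i.1))) := by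
  have he : MeasurePreserving (MeasurableEquiv.piEquivPiSubtypeProd α (fun i => i = i₀)) (Measure.pi μ)
      ((Measure.pi fun i : {i // i = i₀} => μ i.1).prod (Measure.pi fun i : {i // ¬ i = i₀} => μ i.1)) := by
    -- (the `Fintype {i // i = i₀}` instances `Subtype.fintype` ∕ `Fintype.subtypeEq` are propositionally equal)
    convert measurePreserving_piEquivPiSubtypeProd μ (fun i => i = i₀)
  have hu : MeasurePreserving (MeasurableEquiv.piUnique (fun i : {i // i = i₀} => α i.1)) (Measure.pi fun i : {i // i = i₀} => μ i.1) (μ i₀) :=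
    measurePreserving_piUnique (fun i : {i // i = i₀} => μ i.1)
  have heu : MeasurePreserving
      (Prod.map (MeasurableEquiv.piUnique (fun i : {i // i = i₀} => α i.1)) id ∘ MeasurableEquiv.piEquivPiSubtypeProd α (fun i => i = i₀))
      (Measure.pi μ) ((μ i₀).prod (Measure.pi fun i : {i // ¬ i = i₀} => μ i.1)) :=
    (hu.prod (MeasurePreserving.id _)).comp he
  have h1 : MeasurePreserving
      (Prod.map (id : A → A) (Prod.map (MeasurableEquiv.piUnique (fun i : {i // i = i₀} => α i.1)) id ∘ MeasurableEquiv.piEquivPiSubtypeProd α (fun i => i = i₀)))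
      (μA.prod (Measure.pi μ)) (μA.prod ((μ i₀).prod (Measure.pi fun i : {i // ¬ i = i₀} => μ i.1))) :=
    (MeasurePreserving.id μA).prod heu
  -- the shuffle `A × (X × Y) → (A × X) × Y → (X × A) × Y → X × (A × Y)`
  have h2 : MeasurePreserving (MeasurableEquiv.prodAssoc : (A × α i₀) × (∀ i : {i // ¬ i = i₀}, α i.1) ≃ᵐ A × (α i₀ × (∀ i : {i // ¬ i = i₀}, α i.1))).symm
      (μA.prod ((μ i₀).prod (Measure.pi fun i : {i // ¬ i = i₀} => μ i.1))) ((μA.prod (μ i₀)).prod (Measure.pi fun i : {i // ¬ i = i₀} => μ i.1)) :=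
    (measurePreserving_prodAssoc μA (μ i₀) (Measure.pi fun i : {i // ¬ i = i₀} => μ i.1)).symm _
  have h3 : MeasurePreserving (Prod.map (Prod.swap : A × α i₀ → α i₀ × A) (id : (∀ i : {i // ¬ i = i₀}, α i.1) → (∀ i : {i // ¬ i = i₀}, α i.1)))
      ((μA.prod (μ i₀)).prod (Measure.pi fun i : {i // ¬ i = i₀} => μ i.1)) (((μ i₀).prod μA).prod (Measure.pi fun i : {i // ¬ i = i₀} => μ i.1)) :=
    MeasurePreserving.prod measurePreserving_swap (MeasurePreserving.id _)
  have h4 : MeasurePreserving (MeasurableEquiv.prodAssoc : (α i₀ × A) × (∀ i : {i // ¬ i = i₀}, α i.1) ≃ᵐ α i₀ × (A × (∀ i : {i // ¬ i = i₀}, α i.1)))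
      (((μ i₀).prod μA).prod (Measure.pi fun i : {i // ¬ i = i₀} => μ i.1)) ((μ i₀).prod (μA.prod (Measure.pi fun i : {i // ¬ i = i₀} => μ i.1))) :=
    measurePreserving_prodAssoc (μ i₀) μA (Measure.pi fun i : {i // ¬ i = i₀} => μ i.1)
  have key := h4.comp (h3.comp (h2.comp h1))
  convert key using 1
  funext z
  rfl

/-- **ISOLATION OF ONE COORDINATE (integrability-free Fubini for an integrand pure at `i₀`).**  For the finite product measure `μA ⊗ ⨂_{i∈ι} μ_i` (`ι` a `Fintype`, all measures
σ-finite), a weight `ΨA(a) · ∏_i Ψ_i(q_i)` and an integrand PURE AT `i₀`, `F(a, q) = B(q_{i₀}) · R(a, q|_{i≠i₀})`: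
`∫ (ΨA(a)·∏_i Ψ_i(q_i))·F(a,q) d(μA ⊗ ⨂_i μ_i) = (∫ Ψ_{i₀}(y)·B(y) dμ_{i₀}(y)) · ∫ (ΨA(a)·∏_{i≠i₀} Ψ_i(q_i))·R(a,q) d(μA ⊗ ⨂_{i≠i₀} μ_i)`.
No integrability hypothesis: both sides take junk values consistently (Mathlib `integral_prod_mul` after the measure-preserving split `measurePreserving_splitAt`).  This is the shape of
★ G1 `whittakerDelta_eq_mul_tprod_euler`'s Euler HEAD (`A := N_Δ(L ⊗ ℝ)`, `ι := ↥T`, `Ψ` the conjugate local characters). [cite: Folland1995, §2.2] [cite: Tan1999, §3]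
[cite: KudlaRallis1994, §2] -/
theorem integral_prod_pi_eq_mul_of_pureAt (ΨA : A → ℂ) (Ψ : ∀ i, α i → ℂ) (F : A × (∀ i, α i) → ℂ)
    (B : α i₀ → ℂ) (R : A × (∀ i : {i // i ≠ i₀}, α i.1) → ℂ)
    (hpure : ∀ (a : A) (q : ∀ i, α i), F (a, q) = B (q i₀) * R (a, fun i : {i // i ≠ i₀} => q i.1)) :
    ∫ z, (ΨA z.1 * ∏ i, Ψ i (z.2 i)) * F z ∂(μA.prod (Measure.pi μ)) =
      (∫ y, Ψ i₀ y * B y ∂(μ i₀)) *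
        ∫ z, (ΨA z.1 * ∏ i : {i // i ≠ i₀}, Ψ i.1 (z.2 i)) * R z ∂(μA.prod (Measure.pi fun i : {i // i ≠ i₀} => μ i.1)) := by
  -- the split is (the coercion of) a measurable equivalence, hence a measurable embedding
  have hEm : MeasurableEmbedding (fun z : A × (∀ i, α i) => (z.2 i₀, (z.1, fun i : {i // i ≠ i₀} => z.2 i.1))) := by
    exact (show A × (∀ i, α i) ≃ᵐ α i₀ × (A × (∀ i : {i // i ≠ i₀}, α i.1)) from
      (MeasurableEquiv.prodCongr (MeasurableEquiv.refl A)
        ((MeasurableEquiv.piEquivPiSubtypeProd α (fun i => i = i₀)).trans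
          (MeasurableEquiv.prodCongr (MeasurableEquiv.piUnique (fun i : {i // i = i₀} => α i.1))
            (MeasurableEquiv.refl (∀ i : {i // ¬ i = i₀}, α i.1))))).trans
      ((MeasurableEquiv.prodAssoc : (A × α i₀) × (∀ i : {i // ¬ i = i₀}, α i.1) ≃ᵐ A × (α i₀ × (∀ i : {i // ¬ i = i₀}, α i.1))).symm.trans
        ((MeasurableEquiv.prodCongr (MeasurableEquiv.prodComm : A × α i₀ ≃ᵐ α i₀ × A) (MeasurableEquiv.refl (∀ i : {i // ¬ i = i₀}, α i.1))).trans
          (MeasurableEquiv.prodAssoc : (α i₀ × A) × (∀ i : {i // ¬ i = i₀}, α i.1) ≃ᵐ α i₀ × (A × (∀ i : {i // ¬ i = i₀}, α i.1)))))).measurableEmbedding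
  calc ∫ z, (ΨA z.1 * ∏ i, Ψ i (z.2 i)) * F z ∂(μA.prod (Measure.pi μ))
      = ∫ z, (fun w : α i₀ × (A × (∀ i : {i // i ≠ i₀}, α i.1)) =>
            (Ψ i₀ w.1 * B w.1) * ((ΨA w.2.1 * ∏ i : {i // i ≠ i₀}, Ψ i.1 (w.2.2 i)) * R w.2))
          ((fun z : A × (∀ i, α i) => (z.2 i₀, (z.1, fun i : {i // i ≠ i₀} => z.2 i.1))) z) ∂(μA.prod (Measure.pi μ)) := by
        congr 1
        funext z
        rcases z with ⟨a, q⟩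
        simp only
        rw [hpure a q, Fintype.prod_eq_mul_prod_subtype_ne (fun i => Ψ i (q i)) i₀]
        ring
    _ = ∫ w, (Ψ i₀ w.1 * B w.1) * ((ΨA w.2.1 * ∏ i : {i // i ≠ i₀}, Ψ i.1 (w.2.2 i)) * R w.2)
          ∂((μ i₀).prod (μA.prod (Measure.pi fun i : {i // i ≠ i₀} => μ i.1))) :=
        (measurePreserving_splitAt μ μA i₀).integral_comp hEm
          (fun w : α i₀ × (A × (∀ i : {i // i ≠ i₀}, α i.1)) => (Ψ i₀ w.1 * B w.1) * ((ΨA w.2.1 * ∏ i : {i // i ≠ i₀}, Ψ i.1 (w.2.2 i)) * R w.2))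
    _ = (∫ y, Ψ i₀ y * B y ∂(μ i₀)) *
          ∫ z, (ΨA z.1 * ∏ i : {i // i ≠ i₀}, Ψ i.1 (z.2 i)) * R z ∂(μA.prod (Measure.pi fun i : {i // i ≠ i₀} => μ i.1)) :=
        integral_prod_mul (fun y => Ψ i₀ y * B y) (fun z : A × (∀ i : {i // i ≠ i₀}, α i.1) => (ΨA z.1 * ∏ i : {i // i ≠ i₀}, Ψ i.1 (z.2 i)) * R z)

/-- **ISOLATION WITH TWO-SIDED TRANSLATES (the literal shape of ★ G1's head).**  Same as `integral_prod_pi_eq_mul_of_pureAt` for the head integrand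
`(ΨA(a)·∏_i Ψ_i(q_i)) · fT(wA·a·hA, (w_i·q_i·h_i)_i)` of ★ `whittakerDelta_eq_mul_tprod_euler`, with `fT` PURE AT `i₀` as a function: `fT(a, q) = bT(q_{i₀})·rT(a, q|_{i≠i₀})`.  Then
`∫ (ΨA·∏Ψ)·fT(wA·a·hA, (w·q·h)) = (∫ Ψ_{i₀}(y)·bT(w_{i₀}·y·h_{i₀}) dμ_{i₀}) · ∫ (ΨA·∏_{i≠i₀}Ψ)·rT(wA·a·hA, (w_i·q_i·h_i)_{i≠i₀})`.  No integrability hypothesis.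
[cite: Folland1995, §2.2] [cite: KudlaRallis1994, §2] [cite: Tan1999, §3] -/
theorem integral_prod_pi_eq_mul_of_pureAt_translate [Mul A] [∀ i, Mul (α i)] (ΨA : A → ℂ) (Ψ : ∀ i, α i → ℂ)
    (fT : A × (∀ i, α i) → ℂ) (bT : α i₀ → ℂ) (rT : A × (∀ i : {i // i ≠ i₀}, α i.1) → ℂ)
    (hpure : ∀ (a : A) (q : ∀ i, α i), fT (a, q) = bT (q i₀) * rT (a, fun i : {i // i ≠ i₀} => q i.1))
    (wA hA : A) (w h : ∀ i, α i) :
    ∫ z, (ΨA z.1 * ∏ i, Ψ i (z.2 i)) * fT (wA * z.1 * hA, fun i => w i * z.2 i * h i) ∂(μA.prod (Measure.pi μ)) =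
      (∫ y, Ψ i₀ y * bT (w i₀ * y * h i₀) ∂(μ i₀)) *
        ∫ z, (ΨA z.1 * ∏ i : {i // i ≠ i₀}, Ψ i.1 (z.2 i)) * rT (wA * z.1 * hA, fun i : {i // i ≠ i₀} => w i.1 * z.2 i * h i.1)
          ∂(μA.prod (Measure.pi fun i : {i // i ≠ i₀} => μ i.1)) :=
  integral_prod_pi_eq_mul_of_pureAt μ μA i₀ ΨA Ψ (fun z => fT (wA * z.1 * hA, fun i => w i * z.2 i * h i))
    (fun y => bT (w i₀ * y * h i₀)) (fun z => rT (wA * z.1 * hA, fun i : {i // i ≠ i₀} => w i.1 * z.2 i * h i.1))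
    (fun a q => hpure (wA * a * hA) (fun i => w i * q i * h i))

end Isolation

/-! ## §2 (T) Transport of the place factorisation from the convergent half-plane to `{0 < re s}` -/

/-- **PLACE-FACTOR TRANSPORT.**  Letters BY VALUE: `WaStar` holomorphic on `{0 < re}` (K1-a♮ `hEad`); the pin `(s − ½)·W s = WaStar s` on `{s₁ < re}` (K1-a♮ `hEac`, `s₁ = n∕2 = 1`);
the isolated tail `W s = Fn s hv · Rst s` on `{s₁ < re}` (§1 at the carriers ∘ ★ G1's Euler head); the local value `Fn(·, hv)` holomorphic on `{0 < re}` ((K1a-3) at `v₀`);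
the pole-cleared rest `(s − ½)·Rst s = G s` on `{s₁ < re}` with `G` holomorphic on `{0 < re}` ((K1a-4) §1 on the `T∖v₀`-tail).  THEN `WaStar s = Fn s hv · G s` on ALL of
`{0 < re s}` — both sides are holomorphic there and agree on `{s₁ < re}`. [cite: KudlaRallis1994, §2] [cite: Tan1999, §4 Prop. 4.8] [cite: GanTakeda2011, Prop. 7.2] -/
theorem waStar_eq_localValue_mul_of_letters {Hv : Type*} (WaStar W : ℂ → ℂ) (Fn : ℂ → Hv → ℂ) (hv : Hv) (Rst G : ℂ → ℂ)
    (hWa : DifferentiableOn ℂ WaStar {s : ℂ | 0 < s.re})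
    {s₁ : ℝ} (hs₁ : 0 ≤ s₁)
    (hpin : ∀ s : ℂ, s₁ < s.re → (s - 1 / 2) * W s = WaStar s)
    (htail : ∀ s : ℂ, s₁ < s.re → W s = Fn s hv * Rst s)
    (hFn : DifferentiableOn ℂ (fun s => Fn s hv) {s : ℂ | 0 < s.re})
    (hG : DifferentiableOn ℂ G {s : ℂ | 0 < s.re})
    (hGR : ∀ s : ℂ, s₁ < s.re → (s - 1 / 2) * Rst s = G s) :
    ∀ s : ℂ, 0 < s.re → WaStar s = Fn s hv * G s := by
  refine eqOn_halfPlane_of_eqOn_right hWa (hFn.mul hG) hs₁ fun s hs => ?_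
  rw [← hpin s hs, htail s hs, ← hGR s hs]
  ring

/-- **B1's LOCAL-KERNEL FACTORISATION LETTER `hfac`, per `(h, X, j)`, from the place letters** (the `∃ hv G, ContinuousAt G ½ ∧ ContinuousAt (Fn · hv) ½ ∧ ∀ s, 0 < re s → s ≠ ½ →
WaStar s = Fn s hv * G s` shape of `K2LiuLocalKernelZeroResidue.resGen_eq_zero_of_localKernel_letters`, token for token): witnesses `hv`, `G`; the two continuity clauses
from holomorphy at the interior point `½` (★ U0 `continuousAt_half_of_differentiableOn`), the identity from `waStar_eq_localValue_mul_of_letters` (it even holds AT `½`).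
[cite: KudlaRallis1994, §2] [cite: GanTakeda2011, Prop. 7.2] [cite: MoeglinWaldspurger1995, IV.1.9–IV.1.11] -/
theorem exists_localKernel_factor_of_letters {Hv : Type*} (WaStar W : ℂ → ℂ) (Fn : ℂ → Hv → ℂ) (hv : Hv) (Rst G : ℂ → ℂ)
    (hWa : DifferentiableOn ℂ WaStar {s : ℂ | 0 < s.re})
    {s₁ : ℝ} (hs₁ : 0 ≤ s₁)
    (hpin : ∀ s : ℂ, s₁ < s.re → (s - 1 / 2) * W s = WaStar s)
    (htail : ∀ s : ℂ, s₁ < s.re → W s = Fn s hv * Rst s)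
    (hFn : DifferentiableOn ℂ (fun s => Fn s hv) {s : ℂ | 0 < s.re})
    (hG : DifferentiableOn ℂ G {s : ℂ | 0 < s.re})
    (hGR : ∀ s : ℂ, s₁ < s.re → (s - 1 / 2) * Rst s = G s) :
    ∃ (hv' : Hv) (G' : ℂ → ℂ), ContinuousAt G' (1 / 2) ∧ ContinuousAt (fun s => Fn s hv') (1 / 2) ∧
      ∀ s : ℂ, 0 < s.re → s ≠ 1 / 2 → WaStar s = Fn s hv' * G' s :=
  ⟨hv, G, continuousAt_half_of_differentiableOn (Es := fun s (_ : Unit) => G s) (fun _ => hG) (),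
    continuousAt_half_of_differentiableOn (Es := fun s (_ : Unit) => Fn s hv) (fun _ => hFn) (),
    fun s hs _ => waStar_eq_localValue_mul_of_letters WaStar W Fn hv Rst G hWa hs₁ hpin htail hFn hG hGR s hs⟩

/-- **THE SAME, FAMILY FORM** — for a family of letters indexed by the consumer's `(h, X, j)`-data `κ` (one local value `Fn` for all indices, as B1 takes it): per index `k`, the
place letters `(WaStar k, W k, hv k, Rst k, G k)` ⊢ B1's `hfac` clause at `k`. [cite: KudlaRallis1994, §2] [cite: GanTakeda2011, Prop. 7.2] -/
theorem forall_exists_localKernel_factor_of_letters {κ Hv : Type*} (WaStar W : κ → ℂ → ℂ) (Fn : ℂ → Hv → ℂ) (hv : κ → Hv) (Rst G : κ → ℂ → ℂ)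
    (hWa : ∀ k, DifferentiableOn ℂ (WaStar k) {s : ℂ | 0 < s.re})
    {s₁ : ℝ} (hs₁ : 0 ≤ s₁)
    (hpin : ∀ k, ∀ s : ℂ, s₁ < s.re → (s - 1 / 2) * W k s = WaStar k s)
    (htail : ∀ k, ∀ s : ℂ, s₁ < s.re → W k s = Fn s (hv k) * Rst k s)
    (hFn : ∀ k, DifferentiableOn ℂ (fun s => Fn s (hv k)) {s : ℂ | 0 < s.re})
    (hG : ∀ k, DifferentiableOn ℂ (G k) {s : ℂ | 0 < s.re})
    (hGR : ∀ k, ∀ s : ℂ, s₁ < s.re → (s - 1 / 2) * Rst k s = G k s) (k : κ) :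
    ∃ (hv' : Hv) (G' : ℂ → ℂ), ContinuousAt G' (1 / 2) ∧ ContinuousAt (fun s => Fn s hv') (1 / 2) ∧
      ∀ s : ℂ, 0 < s.re → s ≠ 1 / 2 → WaStar k s = Fn s hv' * G' s :=
  exists_localKernel_factor_of_letters (WaStar k) (W k) Fn (hv k) (Rst k) (G k) (hWa k) hs₁ (hpin k) (htail k) (hFn k) (hG k) (hGR k)

end Summit.HodgeConjecture.HodgeConjecture.Cruxes.HLiu418.K2LiuSingularWhittakerPlaceFactor

end
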